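import Mathlib.FieldTheory.IsAlgClosed.Basic
import Mathlib.Analysis.Complex.Polynomial.Basic
import Mathlib.LinearAlgebra.FiniteDimensional.Lemmas
import Literature.AlgebraicGeometry.Frobenioids.ArchimedeanBaseComparison
import Literature.AlgebraicGeometry.Motives.AlgPointsNonempty
import HarnessLib

/-!
# Frobenioids II, §3: the skeleton `ArchFrd.D0` IS `D₀` — `D0.toArchBase` is an equivalence

Mochizuki, *The geometry of Frobenioids II: poly-Frobenioids*, Kyushu J. Math. **62** (2008)
401–460, §3 p. 23 [cite: MochizukiFrdII2008, §3 p.23]: `D₀` = connected finite étale coverings of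
`Spec ℝ`; Definition 3.1 (i) p. 23: an archimedean local field is `ℝ` or `ℂ`, "`ℝ` has no nontrivial
automorphisms, while the unique nontrivial automorphism of … `ℂ` is given by complex conjugation",
and every inclusion `K ↪ L` of archimedean local fields is an isomorphism or `ℝ ↪ ℂ`.

This file DISCHARGES the named statement `ArchFrd.D0.ToArchBaseIsEquivalence` of
`ArchimedeanBaseComparison.lean`: the comparison functor from the two-object skeleton `ArchFrd.D0`
(over which Example 3.3 is built) to abc-iut-L1-t4's `ArchBase = FinEtale ℝ` is FULL (the only
`ℝ`-algebra maps among `ℝ`, `ℂ` are `id_ℝ`, `ℝ ↪ ℂ`, `id_ℂ`, `conj`; there is none `ℂ → ℝ`),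
FAITHFUL (already proved; "no `ℝ`-algebra map `ℂ → ℝ`" is the tree's
`Literature.AlgebraicGeometry.Motives.isEmpty_complex_algHom_real`) and ESSENTIALLY SURJECTIVE (a finite extension of `ℝ` has degree `1` or `2`,
t4's `ArchBase.isReal_or_isComplex`, hence is `ℝ`-isomorphic to `ℝ` or to `ℂ`). Consequently every
equivalence-invariant statement typed over the skeleton is a statement about the printed `D₀`.
-/

namespace Literature.AlgebraicGeometry.Frobenioids

open CategoryTheory

noncomputable section

namespace ArchFrd

namespace D0

/-- An isomorphism of `FinEtale F` from an `F`-algebra isomorphism of the fields (Spec-direction: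
the arrow `X ⟶ Y` carries `e.symm : Y →ₐ X`). [cite: MochizukiFrdII2008, §3 p.23] -/
def isoOfAlgEquiv {F : Type*} [Field F] {X Y : FinEtale F} (e : X ≃ₐ[F] Y) : X ≅ Y where
  hom := ⟨e.symm.toAlgHom⟩
  inv := ⟨e.toAlgHom⟩
  hom_inv_id := FinEtale.hom_ext (by
    change (e.symm.toAlgHom).comp e.toAlgHom = AlgHom.id F X
    ext x; exact e.symm_apply_apply x)
  inv_hom_id := FinEtale.hom_ext (by
    change e.toAlgHom.comp e.symm.toAlgHom = AlgHom.id F Y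
    ext y; exact e.apply_symm_apply y)

/-- A real object of `ArchBase` (`[K : ℝ] = 1`) is `ℝ`-isomorphic to `Spec ℝ`.
[cite: MochizukiFrdII2008, Def 3.1 (i) p.23] -/
def algEquivOfIsReal (Y : ArchBase) (h : ArchBase.IsReal Y) : ℝ ≃ₐ[ℝ] Y :=
  AlgEquiv.ofBijective (Algebra.ofId ℝ Y)
    ⟨(algebraMap ℝ Y).injective,
      (LinearMap.injective_iff_surjective_of_finrank_eq_finrank
          (f := (Algebra.ofId ℝ Y).toLinearMap) (by rw [Module.finrank_self]; exact h.symm)).mp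
        (algebraMap ℝ Y).injective⟩

/-- A complex object of `ArchBase` (`[K : ℝ] = 2`) is `ℝ`-isomorphic to `Spec ℂ` (embed into the
algebraically closed `ℂ` and count dimensions). [cite: MochizukiFrdII2008, Def 3.1 (i) p.23] -/
def algEquivOfIsComplex (Y : ArchBase) (h : ArchBase.IsComplex Y) : Y ≃ₐ[ℝ] ℂ :=
  haveI : Algebra.IsAlgebraic ℝ Y := Algebra.IsAlgebraic.of_finite ℝ Y
  let f : Y →ₐ[ℝ] ℂ := IsAlgClosed.lift
  AlgEquiv.ofBijective f
    ⟨f.toRingHom.injective,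
      (LinearMap.injective_iff_surjective_of_finrank_eq_finrank (f := f.toLinearMap)
          (by rw [Complex.finrank_real_complex]; exact h)).mp f.toRingHom.injective⟩

/-- `toArchBase` is essentially surjective: every connected finite étale `ℝ`-scheme is `Spec ℝ` or
`Spec ℂ` up to isomorphism (t4's `ArchBase.isReal_or_isComplex`).
[cite: MochizukiFrdII2008, Def 3.1 (i) p.23] -/
theorem toArchBase_essSurj : toArchBase.EssSurj := by
  refine ⟨fun Y => ?_⟩
  rcases ArchBase.isReal_or_isComplex Y with h | h
  · exact ⟨real, ⟨isoOfAlgEquiv (algEquivOfIsReal Y h)⟩⟩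
  · exact ⟨complex, ⟨(isoOfAlgEquiv (algEquivOfIsComplex Y h)).symm⟩⟩

/-- `toArchBase` is full: the `ℝ`-algebra maps among `ℝ` and `ℂ` are exactly `id`, `ℝ ↪ ℂ`, `id`,
`conj` — "the unique nontrivial automorphism of … `ℂ` is given by complex conjugation"
(Mathlib `Complex.real_algHom_eq_id_or_conj`). [cite: MochizukiFrdII2008, Def 3.1 (i) p.23] -/
theorem toArchBase_full : toArchBase.Full := by
  refine ⟨fun {K L} g => ?_⟩
  cases K <;> cases L
  · exact ⟨𝟙 real, FinEtale.hom_ext (Subsingleton.elim (α := ℝ →ₐ[ℝ] ℝ) _ _)⟩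
  · exact (Literature.AlgebraicGeometry.Motives.isEmpty_complex_algHom_real.false g.alg).elim
  · exact ⟨toRealHom, FinEtale.hom_ext (Subsingleton.elim (α := ℝ →ₐ[ℝ] ℂ) _ _)⟩
  · rcases Complex.real_algHom_eq_id_or_conj g.alg with h | h
    · refine ⟨Hom.gal false, FinEtale.hom_ext ?_⟩
      change galAlgHom false = g.alg
      rw [galAlgHom_false, h]
    · refine ⟨Hom.gal true, FinEtale.hom_ext ?_⟩
      change galAlgHom true = g.alg
      rw [galAlgHom_true, h]

/-- **The skeleton is `D₀`**: `ArchFrd.D0.toArchBase : D0 ⥤ ArchBase` is an equivalence of categories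
— DISCHARGES `ArchFrd.D0.ToArchBaseIsEquivalence`. [cite: MochizukiFrdII2008, §3 p.23] -/
theorem toArchBaseIsEquivalence_holds : ToArchBaseIsEquivalence :=
  { faithful := toArchBase_faithful
    full := toArchBase_full
    essSurj := toArchBase_essSurj }

/-- The equivalence `D₀^skel ≌ D₀` as data. [cite: MochizukiFrdII2008, §3 p.23] -/
def equivArchBase : D0 ≌ ArchBase :=
  haveI : toArchBase.IsEquivalence := toArchBaseIsEquivalence_holds
  toArchBase.asEquivalence

end D0

end ArchFrd

end

end Literature.AlgebraicGeometry.Frobenioids
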